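import Mathlib
import HarnessLib
import Summits.NavierStokesRegularity.NavierStokesRegularity.Theses.SymmetryModuliCount
import Literature.Analysis.FluidPDE.TypeIAncientMild
import Summits.NavierStokesRegularity.NavierStokesRegularity.Theorems.SymmetryModuliCountFarPastLedger
import Summits.NavierStokesRegularity.NavierStokesRegularity.Theorems.SymmetryModuliCountAxisymEndLiouville
import Summits.NavierStokesRegularity.NavierStokesRegularity.Theorems.SymmetryModuliCountHelicalEndLiouville
import Summits.NavierStokesRegularity.NavierStokesRegularity.Theorems.SymmetryModuliCountForcedSymmetryCollapse
import Summits.NavierStokesRegularity.NavierStokesRegularity.Theorems.SymmetryModuliCountForcedSymmetryStubPressurePackage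
import Summits.NavierStokesRegularity.NavierStokesRegularity.Theorems.SymmetryModuliCountAxisymEndLiouvilleOfFarPastLedgerCubic
import Summits.NavierStokesRegularity.NavierStokesRegularity.Theorems.SymmetryModuliCountForcedSymmetryStubLerayRateEnergy
import Summits.NavierStokesRegularity.NavierStokesRegularity.Theorems.SymmetryModuliCountForcedSymmetryStubBlowDownDriver
import Summits.NavierStokesRegularity.NavierStokesRegularity.Theorems.SymmetryModuliCountForcedSymmetryStubBlowDownDriverStPull
import Summits.NavierStokesRegularity.NavierStokesRegularity.Theorems.SymmetryModuliCountForcedSymmetryUniqueBlowDown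
import Summits.NavierStokesRegularity.NavierStokesRegularity.Theorems.SymmetryModuliCountForcedSymmetrySelfSimilarVertexLeaf
import Summits.NavierStokesRegularity.NavierStokesRegularity.Theorems.SymmetryModuliCountForcedSymmetryBlowDownCentre

/-!
# Crux `ForcedSymmetry` (stmt-NavierStokesRegularity-4052), line `blow-down-census`: the UNCONDITIONAL residual

Route `SymmetryModuliCount`, sub-problem `NavierStokesRegularity`.  Lead file (gen 3, seat `c2`, 2026-08-16).

With the far-past ledger `FarPastLedger` (route item stmt-14060, `Theorems.FarPastLedger_proof`) and the slice
harmonic analysis of the Oseen pressure (`Theorems.stub_fplSlicePressure`) now IN THE TREE, every conditional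
statement the line produced becomes unconditional.  This file records, importably and sorry-free, over the LANDED
drivers only (it deliberately does not import `…ForcedSymmetryAsymptoticallySelfSimilar`):

* `pressurePackage_of_ledger` — the pressure package of the ledger class `A_C ∩ 𝒦_K`, now a theorem.
* `forcedSymmetry_iff_typeIAncientLiouville` — **the crux is equivalent to the route target**
  `X = TypeIAncientLiouville`, unconditionally (time-anchor collapse + the PROVED Killing leaves, items 14061/14062).
* `forcedSymmetry_iff_blowDownLimitSelfSimilar` — **the crux is equivalent to the line's one open registered stub**
  `stub_blowDownLimitSelfSimilar` (skeleton `Cruxes/ForcedSymmetry/Lines/blow_down_census.lean`, gen 3), unconditionally.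
* `liouville_of_uniqueBlowDown` — **what the line proves about `A_C` with no hypothesis left**: an element of `A_C` with ONE
  pointwise-convergent blow-down family `c • v (t₁ + c² s, x₁ + c • y) → W s y` (`c → ∞`) at some centre `(t₁, x₁)`,
  `t₁ ≤ 0`, vanishes identically on `t < 0` (the ancient analogue of Chae 2007 Thm 1.1, in the Type-I KNSS-mild class);
  `typeIAncientLiouville_of_uniqueBlowDown` is the corresponding route-level statement (the card's `UniqueBlowDown ⇒ X`).

So after gen 3 the line `blow-down-census` has no known-type content left: its single open stub is exactly the open
Type-I Liouville problem X (KNSS 2009 §6; Bradshaw–Tsai 2017 OP 5.1; Seregin 2014 notes, Conjecture p. 113).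
-/

noncomputable section

-- the summit and its single problem share the name (D-0017 nested layout)
set_option linter.dupNamespace false

open MeasureTheory Set Metric Filter Function TopologicalSpace
open scoped ENNReal NNReal Topology
open Literature.Analysis.FluidPDE
open Summit.NavierStokesRegularity.NavierStokesRegularity.Theses.SymmetryModuliCount
open Summit.NavierStokesRegularity.NavierStokesRegularity.Theorems
open Summit.NavierStokesRegularity.NavierStokesRegularity.Theorems.AxisymEndLiouvilleOfFarPastLedger
  (lintegral_parabolicCylinder_le)

namespace Summit.NavierStokesRegularity.NavierStokesRegularity.Theorems.SymmetryModuliCountForcedSymmetry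

/-! ### The two known-type inputs of the line, now theorems -/

/-- **The pressure package of the ledger class** (unconditional): for every `C, K` there is `D₀` such that every
backward shift `w(· − T)`, `0 < T ≤ 1`, of a `w ∈ A_C` with ledger constant `K` is a suitable weak solution in the unit
parabolic ball with a pressure `q`, `∫_{Q(0,1)} |q|^{3/2} ≤ D₀`.  (`stub_pressurePackage_of_slicePressure` applied to the
landed slice-pressure lemma `stub_fplSlicePressure`.) [cite: AlbrittonBarker2019, Def. 2.1 and §3; KochNadirashviliSereginSverak2009, §3–4] -/
theorem pressurePackage_of_ledger :
    ∀ (C K : ℝ), ∃ D₀ : ℝ,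
      ∀ w : ℝ → EuclideanSpace ℝ (Fin 3) → EuclideanSpace ℝ (Fin 3), IsTypeIAncientMild C w →
        (∀ t < 0, ∀ (x₀ : EuclideanSpace ℝ (Fin 3)) (R : ℝ), 0 < R →
          ∫ x in ball x₀ R, ‖w t x‖ ^ 2 ≤ K * R) →
        ∀ T ∈ Ioc (0 : ℝ) 1, ∃ q : ℝ → EuclideanSpace ℝ (Fin 3) → ℝ,
          IsSuitableWeakSolutionInBall 1 0 (fun s y => w (s - T) y) q ∧
          ∫⁻ z in parabolicCylinder 1 (0 : ℝ × EuclideanSpace ℝ (Fin 3)), ‖q z.1 z.2‖ₑ ^ (3 / 2 : ℝ) ≤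
            ENNReal.ofReal D₀ :=
  stub_pressurePackage_of_slicePressure stub_fplSlicePressure

/-! ### The crux is the route target -/

/-- **The crux `ForcedSymmetry` is equivalent to the route target `X = TypeIAncientLiouville`**, unconditionally:
the time-anchor collapse (`typeIAncientLiouville_iff_forcedSymmetry_of_killingLeaves`) with the two Killing leaves
now PROVED route items (`HelicalEndLiouville`, stmt-14062; `AxisymEndLiouville`, stmt-14061). [folklore] -/
theorem forcedSymmetry_iff_typeIAncientLiouville : ForcedSymmetry ↔ TypeIAncientLiouville :=
  (typeIAncientLiouville_iff_forcedSymmetry_of_killingLeaves symmetryModuliCount_helicalEndLiouville_proof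
    AxisymEndLiouville_of).symm

/-! ### Liouville under uniqueness of blow-downs -/

/-- **Liouville for Type-I ancient mild solutions with one convergent blow-down family** (unconditional): if
`v ∈ A_C` has, at some centre `(t₁, x₁)` with `t₁ ≤ 0`, a blow-down family `c • v (t₁ + c² s, x₁ + c • y)` converging
pointwise on `s < 0` as `c → ∞`, then `v ≡ 0` on `t < 0`.  Ledger ⇒ pressure package ⇒ the landed driver produces, at a
point where `v ≠ 0`, a subsequential blow-down limit `W ∈ A_C` singular at the origin; blow-down limits do not depend on
the centre (`tendsto_blowDown_centre`), so `W` is the limit of the whole family, hence scaling invariant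
(`generator_eq_zero_of_tendsto_blowDown`), hence zero by the self-similar vertex leaf — contradiction.  In words: a nonzero
Type-I KNSS-mild ancient solution is NOT asymptotically self-similar at `−∞` at any centre. [cite: AlbrittonBarker2019, Lemma 2.2, Prop. 2.3, §3; Tsai1998, Thm 1; KochNadirashviliSereginSverak2009, §4] -/
theorem liouville_of_uniqueBlowDown
    {C : ℝ} {v : ℝ → EuclideanSpace ℝ (Fin 3) → EuclideanSpace ℝ (Fin 3)} (hv : IsTypeIAncientMild C v)
    {t₁ : ℝ} (ht₁ : t₁ ≤ 0) (x₁ : EuclideanSpace ℝ (Fin 3))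
    (hW : ∃ W : ℝ → EuclideanSpace ℝ (Fin 3) → EuclideanSpace ℝ (Fin 3), ∀ s < (0 : ℝ), ∀ y : EuclideanSpace ℝ (Fin 3),
      Tendsto (fun c : ℝ => c • v (t₁ + c ^ 2 * s) (x₁ + c • y)) atTop (𝓝 (W s y))) :
    ∀ t < 0, ∀ x, v t x = 0 := by
  intro t ht x
  by_contra hx
  obtain ⟨W', hW'⟩ := hW
  -- the ledger, the pressure package and the cubic bound of the class `A_C ∩ {ledger K}`
  obtain ⟨K, hK⟩ := stub_lerayRateEnergy_of_farPastLedger FarPastLedger_proof C v hv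
  obtain ⟨D₀, hD₀⟩ := pressurePackage_of_ledger C K
  have hcubic : ∀ w : ℝ → EuclideanSpace ℝ (Fin 3) → EuclideanSpace ℝ (Fin 3), IsTypeIAncientMild C w →
      (∀ t < 0, ∀ (x₀ : EuclideanSpace ℝ (Fin 3)) (R : ℝ), 0 < R →
        ∫ x in ball x₀ R, ‖w t x‖ ^ 2 ≤ K * R) →
      ∫⁻ z in parabolicCylinder 1 (0 : ℝ × EuclideanSpace ℝ (Fin 3)), ‖w z.1 z.2‖ₑ ^ (3 : ℕ) ≤
        ENNReal.ofReal (2 * C * K) := fun w hw hKw => by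
    simpa using lintegral_parabolicCylinder_le hw hKw (z := (0 : ℝ × EuclideanSpace ℝ (Fin 3))) le_rfl one_pos
  -- blow down at `(t, x)`: a subsequential limit `W ∈ A_C` at some centre `(t₂, x₂)`, singular at the origin
  obtain ⟨t₂, x₂, c, W, ht₂, hcpos, hctop, hWA, hpt, hsing⟩ :=
    stub_blowDownDriver C K D₀ hcubic hD₀ v hv hK t ht x hx
  -- the whole family converges at `(t₂, x₂)` too (limits do not depend on the centre), to `W'`, which agrees with `W`
  have hfull' : ∀ s < (0 : ℝ), ∀ y : EuclideanSpace ℝ (Fin 3),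
      Tendsto (fun c : ℝ => c • v (t₂ + c ^ 2 * s) (x₂ + c • y)) atTop (𝓝 (W' s y)) :=
    fun s hs y => tendsto_blowDown_centre hv ht₁ ht₂ x₁ x₂ hs y (W' s y) (hW' s hs y)
  have hWW' : ∀ s < (0 : ℝ), ∀ y : EuclideanSpace ℝ (Fin 3), W' s y = W s y := by
    intro s hs y
    have h1 : Tendsto (fun k => c k • v (t₂ + c k ^ 2 * s) (x₂ + c k • y)) atTop (𝓝 (W' s y)) :=
      (hfull' s hs y).comp hctop
    have h2 : Tendsto (fun k => c k • v (t₂ + c k ^ 2 * s) (x₂ + c k • y)) atTop (𝓝 (W s y)) := by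
      simpa only [smul_stPull_apply] using hpt s hs y
    exact tendsto_nhds_unique h1 h2
  have hfull : ∀ s < (0 : ℝ), ∀ y : EuclideanSpace ℝ (Fin 3),
      Tendsto (fun c : ℝ => c • v (t₂ + c ^ 2 * s) (x₂ + c • y)) atTop (𝓝 (W s y)) := by
    intro s hs y
    rw [← hWW' s hs y]
    exact hfull' s hs y
  -- so `W` is scaling invariant, hence zero on `s < 0` — but it is singular at the origin
  have hgen := generator_eq_zero_of_tendsto_blowDown hWA hfull
  have hW0 : ∀ s < 0, ∀ y, W s y = 0 := selfSimilarOriginVertex_vanishes C W hWA hgen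
  have h1 := hsing 1 one_pos
  have hQm : MeasurableSet (parabolicCylinder 1 (0 : ℝ × EuclideanSpace ℝ (Fin 3))) :=
    (isOpen_parabolicCylinder _ _).measurableSet
  have hae : (uncurry W) =ᵐ[volume.restrict (parabolicCylinder 1 (0 : ℝ × EuclideanSpace ℝ (Fin 3)))] 0 := by
    filter_upwards [ae_restrict_mem hQm] with z hz
    have hs : z.1 < 0 := by
      have := (mem_parabolicCylinder.1 hz).1.2
      simpa using this
    simp [uncurry, hW0 z.1 hs z.2]
  rw [eLpNorm_congr_ae hae, eLpNorm_zero] at h1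
  exact ENNReal.zero_ne_top h1

/-- **The route target from uniqueness of blow-downs** (the card's `UniqueBlowDown ⇒ X`, unconditional): if every
element of every class `A_C` has a pointwise-convergent blow-down family at some centre `(t₁, x₁)`, `t₁ ≤ 0`, then
`X = TypeIAncientLiouville` holds. [cite: AlbrittonBarker2019, §3; Tsai1998, Thm 1] -/
theorem typeIAncientLiouville_of_uniqueBlowDown
    (hU : ∀ (C : ℝ) (v : ℝ → EuclideanSpace ℝ (Fin 3) → EuclideanSpace ℝ (Fin 3)), IsTypeIAncientMild C v →
      ∃ (t₁ : ℝ) (x₁ : EuclideanSpace ℝ (Fin 3)) (W : ℝ → EuclideanSpace ℝ (Fin 3) → EuclideanSpace ℝ (Fin 3)),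
        t₁ ≤ 0 ∧ ∀ s < (0 : ℝ), ∀ y : EuclideanSpace ℝ (Fin 3),
          Tendsto (fun c : ℝ => c • v (t₁ + c ^ 2 * s) (x₁ + c • y)) atTop (𝓝 (W s y))) :
    TypeIAncientLiouville := by
  intro C u hu
  have hv : IsTypeIAncientMild C u := isTypeIAncientMild_iff.2 hu
  obtain ⟨t₁, x₁, W, ht₁, hW⟩ := hU C u hv
  exact liouville_of_uniqueBlowDown hv ht₁ x₁ ⟨W, hW⟩

/-! ### The crux is the line's one open stub -/

/-- **The crux is equivalent to the line's one open registered stub** `stub_blowDownLimitSelfSimilar` of the skeleton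
`Cruxes/ForcedSymmetry/Lines/blow_down_census.lean` (gen 3): "every slice-wise pointwise and locally uniform blow-down
limit `W ∈ A_C` of an element of `A_C` with the Leray-rate ledger is annihilated by the backward scaling generator about
the space–time origin".  (⇐, through X): ledger + pressure package + the landed general driver
`Theorems.ForcedSymmetry.BlowDownCensus.stub_blowDownDriver` give at a point where `u ≠ 0` a singular `L³` limit `U`, a.e.
equal on `Q(0,½)` to a smooth limit `W ∈ A_C`; the stub makes `W` self-similar, the vertex leaf makes it zero, so `U` is not
singular — contradiction; hence X, hence the crux.  (⇒): the crux gives X (`forcedSymmetry_iff_typeIAncientLiouville`), every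
class is `{0}`, and the zero field has vanishing generator. [cite: AlbrittonBarker2019, Lemma 2.2, Prop. 2.3, §3; Tsai1998, Thm 1] -/
theorem forcedSymmetry_iff_blowDownLimitSelfSimilar :
    ForcedSymmetry ↔
    (∀ (C K : ℝ) (v : ℝ → EuclideanSpace ℝ (Fin 3) → EuclideanSpace ℝ (Fin 3)), IsTypeIAncientMild C v →
      (∀ t < 0, ∀ (x₀ : EuclideanSpace ℝ (Fin 3)) (R : ℝ), 0 < R →
        ∫ x in ball x₀ R, ‖v t x‖ ^ 2 ≤ K * R) →
      ∀ (t₁ : ℝ) (x₁ : EuclideanSpace ℝ (Fin 3)), t₁ < 0 →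
      ∀ (c : ℕ → ℝ), (∀ k, 0 < c k) → Tendsto c atTop atTop →
      ∀ (W : ℝ → EuclideanSpace ℝ (Fin 3) → EuclideanSpace ℝ (Fin 3)), IsTypeIAncientMild C W →
        (∀ s < 0, ∀ y, Tendsto (fun k => c k • v (t₁ + c k ^ 2 * s) (x₁ + c k • y)) atTop (𝓝 (W s y))) →
        (∀ s < 0, TendstoLocallyUniformly
          (fun k (y : EuclideanSpace ℝ (Fin 3)) => c k • v (t₁ + c k ^ 2 * s) (x₁ + c k • y)) (W s) atTop) →
        ∀ s < 0, ∀ y, fderiv ℝ (W s) y y + W s y + (2 * s) • timeDeriv W s y = 0) := by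
  rw [forcedSymmetry_iff_typeIAncientLiouville]
  constructor
  · -- (X ⇒ stub): under `X` the class is `{0}`, and the zero field has vanishing generator
    intro hX C K v _ _ t₁ x₁ _ c _ _ W hW _ _ s hs y
    have hW0 : ∀ s < 0, ∀ y, W s y = 0 := hX C W (isTypeIAncientMild_iff.1 hW)
    have hWs : W s = fun _ => 0 := funext (hW0 s hs)
    have hd : timeDeriv W s y = 0 := by
      rw [timeDeriv_apply]
      have hconst : (fun τ => W τ y) =ᶠ[𝓝 s] fun _ => 0 := by
        filter_upwards [Iio_mem_nhds hs] with τ hτ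
        exact hW0 τ hτ y
      rw [hconst.deriv_eq]
      simp
    rw [hd, hWs]
    simp
  · -- (stub ⇒ X): the line's composition over the landed general driver
    intro hS4 C u hu t ht x
    have hA : IsTypeIAncientMild C u := isTypeIAncientMild_iff.2 hu
    by_contra hx
    obtain ⟨K, hK⟩ := stub_lerayRateEnergy_of_farPastLedger FarPastLedger_proof C u hA
    obtain ⟨D₀, hD₀⟩ := pressurePackage_of_ledger C K
    have hcubic : ∀ w : ℝ → EuclideanSpace ℝ (Fin 3) → EuclideanSpace ℝ (Fin 3), IsTypeIAncientMild C w →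
        (∀ t < 0, ∀ (x₀ : EuclideanSpace ℝ (Fin 3)) (R : ℝ), 0 < R →
          ∫ x in ball x₀ R, ‖w t x‖ ^ 2 ≤ K * R) →
        ∫⁻ z in parabolicCylinder 1 (0 : ℝ × EuclideanSpace ℝ (Fin 3)), ‖w z.1 z.2‖ₑ ^ (3 : ℕ) ≤
          ENNReal.ofReal (2 * C * K) := fun w hw hKw => by
      simpa using lintegral_parabolicCylinder_le hw hKw (z := (0 : ℝ × EuclideanSpace ℝ (Fin 3))) le_rfl one_pos
    obtain ⟨t₁, x₁, c, U, W, ht₁, hcpos, hctop, hW, hpt, hlu, hsing, hUW⟩ :=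
      Summit.NavierStokesRegularity.NavierStokesRegularity.Theorems.ForcedSymmetry.BlowDownCensus.stub_blowDownDriver
        C K D₀ hcubic hD₀ u hA hK t x ht hx
    have hss := hS4 C K u hA hK t₁ x₁ ht₁ c hcpos hctop W hW hpt hlu
    have hW0 : ∀ s < 0, ∀ y, W s y = 0 := selfSimilarOriginVertex_vanishes C W hW hss
    -- the singular `L³` limit `U` agrees with `W = 0` a.e. on `Q(0, 1/2)`: not singular, contradiction
    have hsingW : IsBackwardSingularPoint W 0 := isBackwardSingularPoint_zero_of_ae_eq one_half_pos hsing hUW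
    have h1 := hsingW 1 one_pos
    have hQm : MeasurableSet (parabolicCylinder 1 (0 : ℝ × EuclideanSpace ℝ (Fin 3))) :=
      (isOpen_parabolicCylinder _ _).measurableSet
    have hae : (uncurry W) =ᵐ[volume.restrict (parabolicCylinder 1 (0 : ℝ × EuclideanSpace ℝ (Fin 3)))] 0 := by
      filter_upwards [ae_restrict_mem hQm] with z hz
      have hs : z.1 < 0 := by
        have := (mem_parabolicCylinder.1 hz).1.2
        simpa using this
      simp [uncurry, hW0 z.1 hs z.2]
    rw [eLpNorm_congr_ae hae, eLpNorm_zero] at h1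
    exact ENNReal.zero_ne_top h1

end Summit.NavierStokesRegularity.NavierStokesRegularity.Theorems.SymmetryModuliCountForcedSymmetry

end
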